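import Mathlib
import HarnessLib
import Literature.MathematicalPhysics.QuantumLattice.HubbardDiagonalQuadraticEffAction
import Literature.MathematicalPhysics.QuantumLattice.HubbardGridCounterQuadratic
import Summits.HubbardSuperconductivity.HubbardSuperconductivity.Theorems.KLProgrammeKLRegimeWickDressedDefect

/-!
# Route `KLProgramme` — crux K3, ENGINE child (stmt-HubbardSuperconductivity-20437 `KLRegimeEngineV17F2`, gen-8), stub `stub_engine_step_values`, conjunct (E2-F2):
# the kernels of `𝒲_{n+1}` in every degree `≠ 2` are those of the dressed-vertex part ALONE (grid identification of organisation (R1′))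

Cell gate-hubbard-kl, seat hubbard-kl-p1 (g10; (E2) Wick-toolkit lane).  The dressed Wick step `klw_wickAction_succ_dressed` (p524233) reads
`𝒲_{n+1} = e^{Δ_D}(effAction g Q) + S_m(…dressed vertex, ladder term, R₃…)`.  By `effAction_normalCovariance_diagQuadratic` (p529443) the first summand is
explicit: `effAction g Q = Σ_{kσ} (κ/(1+sκ)) ψ̂⁺ψ̂⁻` (the DRESSED two-leg part) and its `D`-smearing adds only a constant (`gaussConv_sum_smul_gen_mul_gen`, p526054).  Hence

* `klw_gaussConv_effAction_twoLegPart` — `e^{Δ_D}(effAction g_{n+1} Q) = Σ_{kσ} (κ/(1+sκ)) ψ̂⁺ψ̂⁻ + const`;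
* `klw_kernel_gaussConv_effAction_twoLegPart_eq_zero` — its kernels vanish in every degree `m ∉ {0, 2}`;
* **`klw_kernel_wickAction_succ_dressed_of_ne_two`** — for `0 < m ≠ 2`: `kernel_m 𝒲_{n+1} = kernel_m S_m( e^{Δ_{D^m+g̃}}V′ − ½·dblFold(…) + e^{Δ_{D^m}}R₃(g̃,V′) )` —
  in particular the Wick PAIR kernel (degree 4) of the history object at the next grid point is read off the dressed-vertex part, which
  `klw_kernel_dressedVertex_eq` (p526054) + `klw_dressingDefect_eq` (p527536) express through `𝒲_n` itself (KLTC-INDEX-v4 §B step 4).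

Exact algebra; nothing about sizes or superconductivity is asserted.  0 kit.
-/

noncomputable section

namespace Summit.HubbardSuperconductivity.HubbardSuperconductivity.Theorems.KLRegimeWick

set_option linter.dupNamespace false -- summit = problem name (single-conjunct summit), D-0017

open Literature.MathematicalPhysics.QuantumLattice GrassmannAlgebra Finset Matrix
open Literature.Probability.LatticeModels
open Summit.HubbardSuperconductivity.HubbardSuperconductivity.Theorems.KLProgrammeLegKernels
open Summit.HubbardSuperconductivity.HubbardSuperconductivity.Theorems.KLRegimeSplit

section Model

variable (L M : ℕ) [NeZero L] [NeZero M] (β U μ : ℝ) (K : TrigPolyC4v)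

/-- **`klw_gaussConv_effAction_twoLegPart`** — the Gaussian part of the dressed step in closed form: with the slice `g_{n+1} = normalCovariance s` and the
diagonal two-leg part `Q = Σ_{kσ} κ ψ̂⁺ψ̂⁻` (`1 + sκ ≠ 0`), for ANY smearing covariance `D`:
`e^{Δ_D}(effAction g_{n+1} Q) = Σ_{kσ} (κ/(1+sκ)) ψ̂⁺_{kσ}ψ̂⁻_{kσ} + algebraMap(Σ_{kσ} (κ/(1+sκ))·½(D(ψ̂⁻,ψ̂⁺) − D(ψ̂⁺,ψ̂⁻)))`. -/
theorem klw_gaussConv_effAction_twoLegPart (n : ℕ) (s κ : FreqMomentum L M × Fin 2 → ℂ) (Q : HubbardGrassmann L M)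
    (D : Matrix (HubbardFieldIdx L M) (HubbardFieldIdx L M) ℂ)
    (hg : klSliceCov L M β μ K (n + 1) = normalCovariance L M s)
    (hQ : Q = ∑ ks : FreqMomentum L M × Fin 2, κ ks • (gen ℂ ((ks, 0) : HubbardFieldIdx L M) * gen ℂ ((ks, 1) : HubbardFieldIdx L M)))
    (hden : ∀ ks : FreqMomentum L M × Fin 2, 1 + s ks * κ ks ≠ 0) :
    gaussConv ℂ D (effAction ℂ (klSliceCov L M β μ K (n + 1)) Q) =
      ∑ ks : FreqMomentum L M × Fin 2, (κ ks / (1 + s ks * κ ks)) • (gen ℂ ((ks, 0) : HubbardFieldIdx L M) * gen ℂ ((ks, 1) : HubbardFieldIdx L M)) +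
        algebraMap ℂ (HubbardGrassmann L M) (∑ ks : FreqMomentum L M × Fin 2, (κ ks / (1 + s ks * κ ks)) * (((1 / 2 : ℚ) • (1 : ℂ)) *
          (D ((ks, 1) : HubbardFieldIdx L M) ((ks, 0) : HubbardFieldIdx L M) - D ((ks, 0) : HubbardFieldIdx L M) ((ks, 1) : HubbardFieldIdx L M)))) := by
  rw [hg, hQ, effAction_normalCovariance_diagQuadratic s κ hden]
  exact gaussConv_sum_smul_gen_mul_gen Finset.univ D (fun ks => κ ks / (1 + s ks * κ ks)) (fun ks => ((ks, 0) : HubbardFieldIdx L M))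
    (fun ks => ((ks, 1) : HubbardFieldIdx L M))

/-- **`klw_kernel_gaussConv_effAction_twoLegPart_eq_zero`** — the Gaussian part of the dressed step has kernels only in degrees `0` and `2`. -/
theorem klw_kernel_gaussConv_effAction_twoLegPart_eq_zero (n : ℕ) (s κ : FreqMomentum L M × Fin 2 → ℂ) (Q : HubbardGrassmann L M)
    (D : Matrix (HubbardFieldIdx L M) (HubbardFieldIdx L M) ℂ)
    (hg : klSliceCov L M β μ K (n + 1) = normalCovariance L M s)
    (hQ : Q = ∑ ks : FreqMomentum L M × Fin 2, κ ks • (gen ℂ ((ks, 0) : HubbardFieldIdx L M) * gen ℂ ((ks, 1) : HubbardFieldIdx L M)))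
    (hden : ∀ ks : FreqMomentum L M × Fin 2, 1 + s ks * κ ks ≠ 0) {m : ℕ} (hm0 : 0 < m) (hm2 : m ≠ 2) (X : Fin m → HubbardFieldIdx L M) :
    kernel ℂ (gaussConv ℂ D (effAction ℂ (klSliceCov L M β μ K (n + 1)) Q)) m X = 0 := by
  rw [klw_gaussConv_effAction_twoLegPart L M β μ K n s κ Q D hg hQ hden, kernel_add, kernel_algebraMap_eq_zero ℂ (HubbardFieldIdx L M) _ hm0, add_zero, kernel_sum]
  exact Finset.sum_eq_zero fun ks _ => by rw [kernel_smul, kernel_gen_mul_gen_of_ne _ _ hm2, mul_zero]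

omit [NeZero M] in
/-- **`klw_kernel_wickAction_succ_dressed_of_ne_two` — grid identification (R1′), degrees `≠ 2`.**  Under the hypotheses of `klw_wickAction_succ_dressed`
(frame `K`, step `n → n+1`; slice symbol `s`, two-leg symbol `κ`, `m = (1+sκ)⁻¹`, `Q`, `V′ = 𝒱_n − Q`, `g̃`, `D^m` by definitional hypotheses; `Z_n ≠ 0`, selection rules,
`1 + sκ ≠ 0`, unit partition functions), for every degree `0 < m ≠ 2` and every label tuple `X`:
`kernel_m 𝒲_{n+1} (X) = kernel_m ( S_m( e^{Δ_{D^m+g̃}}V′ − ½·dblFold((e^{Δ_×(g̃)} − 1)(e^{Δ_×(D^m)}(W̃⁰W̃¹))) + e^{Δ_{D^m}}R₃(g̃,V′) ) ) (X)` — the Gaussian two-leg summand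
contributes nothing outside degrees `0, 2`. -/
theorem klw_kernel_wickAction_succ_dressed_of_ne_two [NeZero M] (n : ℕ) (hZ : klStepPartitionFn L M β U μ K n ≠ 0)
    (s κ : FreqMomentum L M × Fin 2 → ℂ) (m : HubbardFieldIdx L M → ℂ) (Q V' : HubbardGrassmann L M)
    (gt Dm : Matrix (HubbardFieldIdx L M) (HubbardFieldIdx L M) ℂ)
    (hs : s = fun ks =>
      ((hubbardCutoffWeightCT L M β μ K (klScale klE0 (n + 1)) ks.1 : ℂ) - (hubbardCutoffWeightCT L M β μ K (klScale klE0 n) ks.1 : ℂ)) *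
        (((β * (L : ℝ) ^ 2 : ℝ) : ℂ) * ((Complex.I * matsubaraFreq β M ks.1.1 + nambuXiCT L μ K ks.1.2) / nambuDenCT L M β μ 0 K ks.1)))
    (hκ : κ = fun ks => 2 * kernel ℂ (klEffectiveAction L M β U μ K klE0 n) 2 ![((ks, 0) : HubbardFieldIdx L M), (ks, 1)])
    (hm : m = fun X => (1 + s X.1 * κ X.1)⁻¹)
    (hQ : Q = presented ℂ (kernel ℂ (klEffectiveAction L M β U μ K klE0 n) 2))
    (hV' : V' = klEffectiveAction L M β U μ K klE0 n - Q)
    (hgt : gt = normalCovariance L M fun ks => s ks / (1 + s ks * κ ks))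
    (hDm : Dm = Matrix.of fun X Y => m X * m Y * klSoftCov L M β μ K (n + 1) X Y)
    (hplus : ∀ (q : FreqMomentum L M) (σ : Fin 2) (Y : HubbardFieldIdx L M), Y ≠ ((q, σ), 1) →
      kernel ℂ (klEffectiveAction L M β U μ K klE0 n) 2 ![((q, σ), 0), Y] = 0)
    (hminus : ∀ (q : FreqMomentum L M) (σ : Fin 2) (Y : HubbardFieldIdx L M), Y ≠ ((q, σ), 0) →
      kernel ℂ (klEffectiveAction L M β U μ K klE0 n) 2 ![((q, σ), 1), Y] = 0)
    (hden : ∀ ks : FreqMomentum L M × Fin 2, 1 + s ks * κ ks ≠ 0)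
    (hZQ : IsUnit (effPartitionFn ℂ (klSliceCov L M β μ K (n + 1)) Q))
    (hZV : IsUnit (effPartitionFn ℂ gt V')) {d : ℕ} (hd0 : 0 < d) (hd2 : d ≠ 2) (X : Fin d → HubbardFieldIdx L M) :
    kernel ℂ (klWickAction L M β U μ K (n + 1)) d X =
      kernel ℂ (ExteriorAlgebra.map (LinearMap.mulLeft ℂ m)
          (gaussConv ℂ (Dm + gt) V' -
            (2 : ℂ)⁻¹ • dblFold ℂ ((gaussConv ℂ (crossCov ℂ gt) - 1)
              (gaussConv ℂ (crossCov ℂ Dm) (dblCopy ℂ 0 (gaussConv ℂ (Dm + gt) V') * dblCopy ℂ 1 (gaussConv ℂ (Dm + gt) V')))) +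
            gaussConv ℂ Dm (effAction ℂ gt V' - gaussConv ℂ gt V' +
              (2 : ℂ)⁻¹ • (gaussConv ℂ gt (V' * V') - gaussConv ℂ gt V' * gaussConv ℂ gt V')))) d X := by
  -- the two-leg part in diagonal form, the slice in normal form
  have hQsum : Q = ∑ ks : FreqMomentum L M × Fin 2, κ ks • (gen ℂ ((ks, 0) : HubbardFieldIdx L M) * gen ℂ ((ks, 1) : HubbardFieldIdx L M)) := by
    rw [hQ, presented_kernel_two_eq_sum_of_twoLeg _ hplus hminus, hκ]
  have hg : klSliceCov L M β μ K (n + 1) = normalCovariance L M s := by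
    rw [hs]; exact klw_sliceCov_succ_eq_normalCovariance L M β μ K n
  rw [klw_wickAction_succ_dressed L M β U μ K n hZ s κ m Q V' gt Dm hs hκ hm hQ hV' hgt hDm hplus hminus hden hZQ hZV, kernel_add,
    klw_kernel_gaussConv_effAction_twoLegPart_eq_zero L M β μ K n s κ Q (klSoftCov L M β μ K (n + 1)) hg hQsum hden hd0 hd2, zero_add]

end Model

end Summit.HubbardSuperconductivity.HubbardSuperconductivity.Theorems.KLRegimeWick

end
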